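import Summits.Schanuel.Schanuel.Theorems.ZilberEacStripEscape
import Summits.Schanuel.Schanuel.Theorems.ZilberEacGraphSurfaceUnbalanced
import HarnessLib

/-!
# Logarithmic strips, III: zeros of `P(z, e^z)` in logarithmic strips and the growth of `p(z)`
# along them

HONEST FRAMING.  Cell `pub-schanuel` (Zilber's Exponential-Algebraic Closedness, case ladder;
host summit Schanuel), seat 2, gen 17.  The last class of surfaces of Mantova–Masser's case over a
graph base `x₁ = p(x₀)` (`deg p ≥ 2`) not covered by `unprojectedDense_graphSurface` is
`{x₁ = p(x₀), P(x₀, y₀) = 0}` with `P ∈ ℂ[x₀, y₀]` (no `y₁`).  Its exponential points are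
`(z, p(z), e^z, e^{p(z)})` with `P(z, e^z) = 0`: the zeros of a ONE-variable exponential polynomial,
which lie in logarithmic strips `|Re z - μ log|z|| = O(1)` and do NOT escape to `Re z → -∞`; but the
SECOND additive coordinate `x₁ = p(z)` does escape (`|Re p(z_k)| ≍ |z_k|^d`) as soon as
`Re(lc(p)·i^d) ≠ 0`.  This file: `exists_fibreCurve_zeros` (zeros `z_k` of `P(z, e^z)` with
`‖z_k - i n_k‖ ≤ A log n_k + B`, `n_k → ∞`, for every `P` with two monomials of different
`y₀`-degree — upper edge of `(m₁, m₀)`, corrected roots `z₀ - μL = 2πiN + log θ`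
(`exists_lineRoot_log_seq`), engine v4 with `E = 0`) and the growth lemma
`tendsto_growth_eval_of_near_imag`.  Density: `ZilberEacFibreCurveDensity`.  NOT Schanuel's
conjecture (neither used nor implied; EAC ⇏ SC); `EC(3,2)` stays OPEN; instances of an OPEN
question (PLMS 2024, §1 p. 5).
-/

noncomputable section

open Filter Topology Metric Set Complex
open Literature.ModelTheory.Zilber
open Literature.Geometry.Symplectic.RotationBranch (norm_pow_sub_pow_le)

set_option linter.dupNamespace false

namespace Summit.Schanuel.Schanuel.Theorems

/-! ## Part A. Growth of `p(z)` along a sequence `z_k = i n_k + O(log n_k)` -/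

/-- `1 ≤ log (3 + 3x)` for `x ≥ 0`. [folklore] -/
theorem one_le_log_three_add (x : ℝ) (hx : 0 ≤ x) : 1 ≤ Real.log (3 + 3 * x) := by
  have h3 : Real.exp 1 ≤ 3 := by have := Real.exp_one_lt_d9; linarith
  calc (1 : ℝ) = Real.log (Real.exp 1) := (Real.log_exp 1).symm
    _ ≤ Real.log (3 + 3 * x) := Real.log_le_log (Real.exp_pos 1) (by linarith)

/-- **Growth of a polynomial along `i n_k + O(log n_k)`.**  `deg p = d ≥ 1` with
`Re(lc(p) · i^d) ≠ 0`; `n_k → ∞`; `‖z_k - i n_k‖ ≤ A log n_k + B`.  Then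
`|Re p(z_k)| / log(2 + ‖p(z_k)‖) → ∞`. (new) -/
theorem tendsto_growth_eval_of_near_imag (p : Polynomial ℂ) (hd : 1 ≤ p.natDegree)
    (hre : (p.leadingCoeff * I ^ p.natDegree).re ≠ 0) {z : ℕ → ℂ} {n : ℕ → ℝ}
    (hn : Tendsto n atTop atTop) {A B : ℝ} (hA : 0 ≤ A)
    (hz : ∀ k, ‖z k - (n k : ℂ) * I‖ ≤ A * Real.log (n k) + B) :
    Tendsto (fun k => |(p.eval (z k)).re| / Real.log (2 + ‖p.eval (z k)‖)) atTop atTop := by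
  set d : ℕ := p.natDegree with hd_def
  set a : ℂ := p.leadingCoeff with ha_def
  set ℓ : Polynomial ℂ := p.eraseLead with hℓ_def
  set c : ℝ := |(a * I ^ d).re| with hc_def
  have hcpos : 0 < c := abs_pos.2 hre
  set Cℓ : ℝ := coeffNormSum ℓ with hCℓ
  have hCℓ0 : 0 ≤ Cℓ := coeffNormSum_nonneg ℓ
  have hℓdeg : ℓ.natDegree ≤ d - 1 := Polynomial.eraseLead_natDegree_le p
  -- the lower-bound constant `L₀'` of the logarithm and the final comparison function
  set C' : ℝ := (‖a‖ + Cℓ) * 2 ^ d with hC'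
  have hC'0 : 0 ≤ C' := by positivity
  set L₀ : ℝ := max (Real.log (2 + C')) 0 + d with hL₀
  have hL₀pos : 0 < L₀ := by
    have : (1 : ℝ) ≤ d := by exact_mod_cast hd
    have := le_max_right (Real.log (2 + C')) 0
    rw [hL₀]; linarith
  -- the comparison `k ↦ (c/(2L₀)) · n_k / log(3 + 3 n_k) → ∞`
  have hcmp : Tendsto (fun k => c / (2 * L₀) * (n k / Real.log (3 + 3 * n k))) atTop atTop :=
    ((gce_tendsto_div_log_affine (by norm_num : (1 : ℝ) < 3) (by norm_num : (0 : ℝ) < 3)).comp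
      hn).const_mul_atTop (by positivity)
  -- `log x ≤ ε x` eventually, for any `ε > 0`
  have hlog : ∀ ε : ℝ, 0 < ε → ∀ᶠ x : ℝ in atTop, Real.log x ≤ ε * x := by
    intro ε hε
    have h := Real.isLittleO_log_id_atTop.bound hε
    filter_upwards [h, eventually_ge_atTop (1 : ℝ)] with x hx hx1
    simp only [Real.norm_eq_abs, id] at hx
    rw [abs_of_nonneg (by linarith : (0 : ℝ) ≤ x)] at hx
    exact (le_abs_self _).trans hx
  set K : ℝ := ‖a‖ * d * 2 ^ (d - 1) with hK
  have hK0 : 0 ≤ K := by positivity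
  -- eventual conditions
  have hsmall : ∀ᶠ k in atTop, 1 ≤ n k ∧ A * Real.log (n k) + B ≤ n k ∧
      K * (A * Real.log (n k) + B) + Cℓ * 2 ^ (d - 1) ≤ c / 2 * n k := by
    have h0 : ∀ᶠ k in atTop, 1 ≤ n k := hn.eventually_ge_atTop 1
    have h1 := hn.eventually (hlog (c / (8 * (K * A + 1))) (by positivity))
    have h2 : ∀ᶠ k in atTop, 8 * (K * |B| + Cℓ * 2 ^ (d - 1)) / c ≤ n k :=
      hn.eventually_ge_atTop _
    have h3 := hn.eventually (hlog (1 / (2 * (A + 1))) (by positivity))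
    have h4 : ∀ᶠ k in atTop, 2 * |B| ≤ n k := hn.eventually_ge_atTop _
    filter_upwards [h0, h1, h2, h3, h4] with k hk0 hk1 hk2 hk3 hk4
    have hB := le_abs_self B
    have hlog0 : 0 ≤ Real.log (n k) := Real.log_nonneg hk0
    refine ⟨hk0, ?_, ?_⟩
    · have e1 : A * Real.log (n k) ≤ n k / 2 := by
        calc A * Real.log (n k) ≤ A * (1 / (2 * (A + 1)) * n k) :=
              mul_le_mul_of_nonneg_left hk3 hA
          _ = A / (A + 1) * (n k / 2) := by field_simp
          _ ≤ 1 * (n k / 2) := by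
              refine mul_le_mul_of_nonneg_right ?_ (by linarith)
              rw [div_le_one (by linarith)]; linarith
          _ = n k / 2 := one_mul _
      linarith
    · have e1 : K * A * Real.log (n k) ≤ c / 8 * n k := by
        calc K * A * Real.log (n k) ≤ K * A * (c / (8 * (K * A + 1)) * n k) :=
              mul_le_mul_of_nonneg_left hk1 (by positivity)
          _ = (K * A) / (K * A + 1) * (c / 8 * n k) := by field_simp
          _ ≤ 1 * (c / 8 * n k) := by
              refine mul_le_mul_of_nonneg_right ?_ (by positivity)
              rw [div_le_one (by positivity)]; linarith
          _ = c / 8 * n k := one_mul _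
      have e2 : K * |B| + Cℓ * 2 ^ (d - 1) ≤ c / 8 * n k := by
        rw [div_le_iff₀ hcpos] at hk2; linarith
      nlinarith
  -- the pointwise estimate
  have hpt : ∀ k, 1 ≤ n k → A * Real.log (n k) + B ≤ n k →
      K * (A * Real.log (n k) + B) + Cℓ * 2 ^ (d - 1) ≤ c / 2 * n k →
      c / (2 * L₀) * (n k / Real.log (3 + 3 * n k)) ≤
        |(p.eval (z k)).re| / Real.log (2 + ‖p.eval (z k)‖) := by
    intro k hk1 hδn hks
    have hn0 : 0 ≤ n k := by linarith
    set δ : ℝ := A * Real.log (n k) + B with hδ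
    have hwn : ‖z k - (n k : ℂ) * I‖ ≤ δ := hz k
    have hnI : ‖(n k : ℂ) * I‖ = n k := by
      rw [norm_mul, Complex.norm_real, Complex.norm_I, mul_one, Real.norm_eq_abs, abs_of_nonneg hn0]
    have hzM : ‖z k‖ ≤ 2 * n k := by
      have := norm_le_insert' (z k) ((n k : ℂ) * I)
      rw [hnI] at this; linarith
    have hM1 : 1 ≤ 2 * n k := by linarith
    set N1 : ℝ := n k ^ (d - 1) with hN1
    have hN1_1 : 1 ≤ N1 := one_le_pow₀ hk1
    have hnd : n k ^ d = n k * N1 := by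
      rw [hN1, ← pow_succ', Nat.sub_add_cancel hd]
    have h2pow : (2 * n k) ^ (d - 1) = 2 ^ (d - 1) * N1 := by rw [hN1, mul_pow]
    -- (i) `‖z^d - (in)^d‖ ≤ d (2n)^{d-1} δ`
    have hi : ‖z k ^ d - ((n k : ℂ) * I) ^ d‖ ≤ d * (2 ^ (d - 1) * N1) * δ := by
      have h := norm_pow_sub_pow_le hzM (by rw [hnI]; linarith) d
      rw [h2pow] at h
      exact h.trans (mul_le_mul_of_nonneg_left hwn (by positivity))
    -- (ii) `Re (a (in)^d) = n^d Re(a i^d)`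
    have hii : (a * ((n k : ℂ) * I) ^ d).re = n k ^ d * (a * I ^ d).re := by
      rw [mul_pow, show a * ((n k : ℂ) ^ d * I ^ d) = ((n k ^ d : ℝ) : ℂ) * (a * I ^ d) by
        push_cast; ring, Complex.re_ofReal_mul]
    -- (iii) the lower-order part
    have hiii : ‖ℓ.eval (z k)‖ ≤ Cℓ * (2 ^ (d - 1) * N1) := by
      rw [← h2pow]; exact norm_eval_le_of_natDegree_le ℓ hM1 hzM hℓdeg
    -- `|Re p(z)| ≥ (c/2) n`
    have hpz : p.eval (z k) = a * ((n k : ℂ) * I) ^ d + a * (z k ^ d - ((n k : ℂ) * I) ^ d) +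
        ℓ.eval (z k) := by
      rw [eval_eq_eraseLead_add]; ring
    have hRe : c / 2 * n k ≤ |(p.eval (z k)).re| := by
      have e1 : (p.eval (z k)).re = n k ^ d * (a * I ^ d).re +
          (a * (z k ^ d - ((n k : ℂ) * I) ^ d)).re + (ℓ.eval (z k)).re := by
        rw [hpz, Complex.add_re, Complex.add_re, hii]
      have e2 := abs_re_le_norm (a * (z k ^ d - ((n k : ℂ) * I) ^ d))
      have e3 := abs_re_le_norm (ℓ.eval (z k))
      rw [norm_mul] at e2
      have e4 : |n k ^ d * (a * I ^ d).re| = c * (n k * N1) := by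
        rw [abs_mul, abs_of_nonneg (by positivity), hnd, hc_def]; ring
      have e5 : ‖a‖ * ‖z k ^ d - ((n k : ℂ) * I) ^ d‖ + ‖ℓ.eval (z k)‖ ≤
          (K * δ + Cℓ * 2 ^ (d - 1)) * N1 := by
        have := mul_le_mul_of_nonneg_left hi (norm_nonneg a)
        have eK : (K * δ + Cℓ * 2 ^ (d - 1)) * N1 =
            ‖a‖ * (d * (2 ^ (d - 1) * N1) * δ) + Cℓ * (2 ^ (d - 1) * N1) := by rw [hK]; ring
        rw [eK]; linarith
      have e6 : (K * δ + Cℓ * 2 ^ (d - 1)) * N1 ≤ (c / 2 * n k) * N1 :=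
        mul_le_mul_of_nonneg_right hks (by linarith)
      -- triangle inequality for the real parts
      have e7 : |(p.eval (z k)).re| ≥ |n k ^ d * (a * I ^ d).re| -
          (|(a * (z k ^ d - ((n k : ℂ) * I) ^ d)).re| + |(ℓ.eval (z k)).re|) := by
        rw [e1]
        have := abs_add_le (n k ^ d * (a * I ^ d).re + (a * (z k ^ d - ((n k : ℂ) * I) ^ d)).re +
          (ℓ.eval (z k)).re) (-((a * (z k ^ d - ((n k : ℂ) * I) ^ d)).re + (ℓ.eval (z k)).re))
        have h' := abs_add_le (-(a * (z k ^ d - ((n k : ℂ) * I) ^ d)).re) (-(ℓ.eval (z k)).re)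
        rw [abs_neg, abs_neg] at h'
        have e8 : n k ^ d * (a * I ^ d).re + (a * (z k ^ d - ((n k : ℂ) * I) ^ d)).re +
            (ℓ.eval (z k)).re + -((a * (z k ^ d - ((n k : ℂ) * I) ^ d)).re + (ℓ.eval (z k)).re) =
            n k ^ d * (a * I ^ d).re := by ring
        rw [e8] at this
        have e9 : -((a * (z k ^ d - ((n k : ℂ) * I) ^ d)).re + (ℓ.eval (z k)).re) =
            -(a * (z k ^ d - ((n k : ℂ) * I) ^ d)).re + -(ℓ.eval (z k)).re := by ring
        rw [e9] at this
        linarith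
      have e10 : c / 2 * n k * 1 ≤ c / 2 * n k * N1 :=
        mul_le_mul_of_nonneg_left hN1_1 (by positivity)
      have e11 : (c / 2 * n k) * N1 = c * (n k * N1) - c / 2 * n k * N1 := by ring
      linarith
    -- `log(2 + ‖p z‖) ≤ L₀ log(3 + 3n)`
    have hlogle : Real.log (2 + ‖p.eval (z k)‖) ≤ L₀ * Real.log (3 + 3 * n k) := by
      have hndpos : 1 ≤ n k ^ d := one_le_pow₀ hk1
      have hup : ‖p.eval (z k)‖ ≤ C' * n k ^ d := by
        rw [eval_eq_eraseLead_add]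
        have h1 : ‖a * z k ^ d‖ ≤ ‖a‖ * (2 * n k) ^ d := by
          rw [norm_mul, norm_pow]
          exact mul_le_mul_of_nonneg_left (pow_le_pow_left₀ (norm_nonneg _) hzM d) (norm_nonneg _)
        have h2 : ‖ℓ.eval (z k)‖ ≤ Cℓ * (2 * n k) ^ d :=
          (norm_eval_le_of_natDegree_le ℓ hM1 hzM hℓdeg).trans
            (mul_le_mul_of_nonneg_left (pow_le_pow_right₀ hM1 (Nat.sub_le d 1)) hCℓ0)
        calc ‖ℓ.eval (z k) + a * z k ^ d‖ ≤ ‖ℓ.eval (z k)‖ + ‖a * z k ^ d‖ := norm_add_le _ _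
          _ ≤ Cℓ * (2 * n k) ^ d + ‖a‖ * (2 * n k) ^ d := add_le_add h2 h1
          _ = C' * n k ^ d := by rw [hC', mul_pow]; ring
      have hlog3 := one_le_log_three_add (n k) hn0
      have hlogn : Real.log (n k) ≤ Real.log (3 + 3 * n k) :=
        Real.log_le_log (by linarith) (by linarith)
      have hlogn0 : 0 ≤ Real.log (n k) := Real.log_nonneg hk1
      calc Real.log (2 + ‖p.eval (z k)‖) ≤ Real.log ((2 + C') * n k ^ d) := by
            refine Real.log_le_log (by positivity) ?_
            have e : (2 + C') * n k ^ d = 2 * n k ^ d + C' * n k ^ d := by ring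
            rw [e]; linarith
        _ = Real.log (2 + C') + d * Real.log (n k) := by
            rw [Real.log_mul (by positivity) (by positivity), Real.log_pow]
        _ ≤ max (Real.log (2 + C')) 0 * Real.log (3 + 3 * n k) + d * Real.log (3 + 3 * n k) := by
            refine add_le_add ?_ (mul_le_mul_of_nonneg_left hlogn (by positivity))
            calc Real.log (2 + C') ≤ max (Real.log (2 + C')) 0 := le_max_left _ _
              _ = max (Real.log (2 + C')) 0 * 1 := (mul_one _).symm
              _ ≤ max (Real.log (2 + C')) 0 * Real.log (3 + 3 * n k) :=
                  mul_le_mul_of_nonneg_left hlog3 (le_max_right _ _)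
        _ = L₀ * Real.log (3 + 3 * n k) := by rw [hL₀]; ring
    have hlogpos : 0 < Real.log (2 + ‖p.eval (z k)‖) :=
      Real.log_pos (by linarith [norm_nonneg (p.eval (z k))])
    have hlog3pos : 0 < Real.log (3 + 3 * n k) := by
      have := one_le_log_three_add (n k) hn0; linarith
    rw [show c / (2 * L₀) * (n k / Real.log (3 + 3 * n k)) =
      (c / 2 * n k) / (L₀ * Real.log (3 + 3 * n k)) by field_simp]
    exact div_le_div₀ (abs_nonneg _) hRe hlogpos hlogle
  -- conclusion
  refine tendsto_atTop_mono' atTop ?_ hcmp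
  filter_upwards [hsmall] with k hk
  exact hpt k hk.1 hk.2.1 hk.2.2

/-! ## Part B. Zeros of `P(z, e^z)` in a logarithmic strip -/

/-- `P(z, e^z) = Σ_v c_v z^{v₀} (e^{1·z + 0})^{v₁}`. -/
theorem eval₂_exp_eq_sum (P : MvPolynomial (Fin 2) ℂ) (z : ℂ) :
    MvPolynomial.eval ![z, exp z] P =
      ∑ v ∈ P.support, (Polynomial.C (P.coeff v) * Polynomial.X ^ (v 0)).eval z *
        exp (1 * z + 0) ^ (v 1) := by
  rw [MvPolynomial.eval_eq']
  refine Finset.sum_congr rfl fun v _ => ?_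
  simp only [Fin.prod_univ_two, Matrix.cons_val_zero, Matrix.cons_val_one,
    Polynomial.eval_mul, Polynomial.eval_C, Polynomial.eval_pow, Polynomial.eval_X, one_mul,
    add_zero]
  ring

/-- **Zeros of `P(z, e^z)` along a logarithmic strip.**  If `P ∈ ℂ[x, y]` has two monomials of
different `y`-degree, then there are `z_k` with `P(z_k, e^{z_k}) = 0` and `n_k → ∞` with
`‖z_k - i n_k‖ ≤ A log n_k + B` (`A ≥ 0`). (new) -/
theorem exists_fibreCurve_zeros (P : MvPolynomial (Fin 2) ℂ)
    (h1 : ∃ v ∈ P.support, ∃ v' ∈ P.support, v 1 ≠ v' 1) :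
    ∃ (z : ℕ → ℂ) (n : ℕ → ℝ) (A B : ℝ), 0 ≤ A ∧ Tendsto n atTop atTop ∧
      (∀ k, MvPolynomial.eval ![z k, exp (z k)] P = 0) ∧
      ∀ k, ‖z k - (n k : ℂ) * I‖ ≤ A * Real.log (n k) + B := by
  classical
  -- coefficient polynomials and exponents
  set q : (Fin 2 →₀ ℕ) → Polynomial ℂ := fun v =>
    Polynomial.C (P.coeff v) * Polynomial.X ^ (v 0) with hq_def
  set e : (Fin 2 →₀ ℕ) → ℕ := fun v => v 1 with he_def
  have hq_deg : ∀ v ∈ P.support, (q v).natDegree = v 0 := fun v hv =>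
    Polynomial.natDegree_C_mul_X_pow _ _ (MvPolynomial.mem_support_iff.1 hv)
  have hq_lc : ∀ v, (q v).leadingCoeff = P.coeff v := fun v =>
    Polynomial.leadingCoeff_C_mul_X_pow _ _
  -- the upper edge of the points `(v₁, v₀)`
  obtain ⟨μ, κ, hκ, va, hva, vc, hvc, hjne, hja, hjc⟩ := exists_upper_edge P.support e
    (fun v => v 0) h1
  have hκ' : ∀ v ∈ P.support, ((q v).natDegree : ℝ) + μ * e v ≤ κ := fun v hv => by
    rw [hq_deg v hv]; exact hκ v hv
  set Jt := P.support.filter (fun v => ((q v).natDegree : ℝ) + μ * e v = κ) with hJt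
  set Qμ : Polynomial ℂ := ∑ v ∈ Jt, Polynomial.C (q v).leadingCoeff * Polynomial.X ^ (e v)
    with hQμ
  have hmem_top : ∀ {v}, v ∈ P.support → ((v 0 : ℝ) + μ * e v = κ) → v ∈ Jt := fun {v} hv h =>
    Finset.mem_filter.2 ⟨hv, by rw [hq_deg v hv]; exact h⟩
  have hvaT : va ∈ Jt := hmem_top hva hja
  have hvcT : vc ∈ Jt := hmem_top hvc hjc
  have hinj : ∀ v ∈ Jt, ∀ v' ∈ Jt, e v = e v' → v = v' := by
    intro v hv v' hv' hee
    obtain ⟨hvM, hvt⟩ := Finset.mem_filter.1 hv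
    obtain ⟨hv'M, hv't⟩ := Finset.mem_filter.1 hv'
    have h0eq : v 0 = v' 0 := by
      rw [hq_deg v hvM] at hvt; rw [hq_deg v' hv'M] at hv't
      rw [hee] at hvt
      have : (v 0 : ℝ) = v' 0 := by linarith
      exact_mod_cast this
    have h1eq : v 1 = v' 1 := hee
    ext i
    fin_cases i
    · exact h0eq
    · exact h1eq
  have hcoeff : ∀ v₁ ∈ Jt, Qμ.coeff (e v₁) = P.coeff v₁ := by
    intro v₁ hv₁
    rw [hQμ, Polynomial.finsetSum_coeff, Finset.sum_eq_single v₁]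
    · rw [Polynomial.coeff_C_mul, Polynomial.coeff_X_pow, if_pos rfl, mul_one, hq_lc]
    · intro v hv hne
      rw [Polynomial.coeff_C_mul, Polynomial.coeff_X_pow, if_neg, mul_zero]
      exact fun h => hne (hinj v hv v₁ hv₁ h.symm)
    · intro h; exact (h hv₁).elim
  have hca : Qμ.coeff (e va) ≠ 0 := by
    rw [hcoeff va hvaT]; exact MvPolynomial.mem_support_iff.1 hva
  have hcc : Qμ.coeff (e vc) ≠ 0 := by
    rw [hcoeff vc hvcT]; exact MvPolynomial.mem_support_iff.1 hvc
  obtain ⟨θ, hθ0, hθ⟩ : ∃ θ : ℂ, θ ≠ 0 ∧ Qμ.eval θ = 0 := by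
    rcases lt_or_gt_of_ne hjne with hlt | hgt
    · exact exists_root_ne_zero_of_coeff_ne_zero (e vc) Qμ (e va) hlt hca hcc
    · exact exists_root_ne_zero_of_coeff_ne_zero (e va) Qμ (e vc) hgt hcc hca
  have hQ : Qμ ≠ 0 := fun h => hca (by rw [h, Polynomial.coeff_zero])
  -- the corrected roots `z₀ - μL = 2πi(k + K₀ + 1) + log θ`
  set c₀ : ℂ := Complex.log θ with hc₀_def
  have hc₀ : exp c₀ = θ := Complex.exp_log hθ0
  obtain ⟨K₀, z₀, Lg, hroot⟩ := exists_lineRoot_log_seq 1 one_ne_zero 0 c₀ μ 1 (Or.inl rfl)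
  have hLz : ∀ k, exp (Lg k) = z₀ k := fun k => (hroot k).1
  have hz₀θ : ∀ k, exp (1 * z₀ k + 0) = θ * exp ((μ : ℂ) * Lg k) := by
    intro k
    rw [(hroot k).2.1, Complex.exp_add, Complex.exp_add, Complex.exp_int_mul_two_pi_mul_I,
      one_mul, hc₀]
  -- sizes: `n_k = 2π(k + K₀ + 1)`, `‖w_k‖` within `‖c₀‖` of `n_k`
  set nn : ℕ → ℝ := fun k => 2 * Real.pi * (((k + K₀ : ℕ) : ℝ) + 1) with hnn
  have hnn_t : Tendsto nn atTop atTop := by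
    have h := ((tendsto_natCast_add_atTop 1).comp (tendsto_add_atTop_nat K₀)).const_mul_atTop
      Real.two_pi_pos
    refine h.congr fun k => ?_
    simp only [hnn, Function.comp_apply, Nat.cast_add]
  have hw_lo : ∀ k, nn k - ‖c₀‖ ≤
      ‖((((k + K₀ + 1 : ℕ) : ℤ) * (1 : ℤ) : ℤ) : ℂ) * (2 * Real.pi * I) + c₀‖ := by
    intro k; have := (hroot k).2.2.2.2.2.2.1; simp only [sub_zero] at this; exact this
  have hw_hi : ∀ k, ‖((((k + K₀ + 1 : ℕ) : ℤ) * (1 : ℤ) : ℤ) : ℂ) * (2 * Real.pi * I) + c₀‖ ≤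
      nn k + ‖c₀‖ := by
    intro k; have := (hroot k).2.2.2.2.2.2.2; simp only [sub_zero] at this; exact this
  have hz₀norm : Tendsto (fun k => ‖z₀ k‖) atTop atTop := by
    refine tendsto_atTop_mono (fun k => ?_)
      ((tendsto_atTop_add_const_right _ (-‖c₀‖) hnn_t).atTop_div_const (by norm_num : (0:ℝ) < 2))
    have h := (hroot k).2.2.2.2.2.1
    have h' := hw_lo k
    simp only [norm_one, div_one, sub_zero] at h
    linarith
  -- engine v4 with `E = 0`
  have hzeros := exists_strip_zeros (1 : ℂ) 0 one_ne_zero P.support q e μ κ hκ' hθ0 hθ hQ z₀ Lg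
    hLz hz₀θ hz₀norm (fun _ => 0) (differentiable_const _)
    (fun η hη => Filter.Eventually.of_forall fun k u _ => by
      rw [norm_zero]; positivity) zero_lt_one le_rfl
  obtain ⟨K₁, hK₁⟩ := eventually_atTop.1 hzeros
  have hsol : ∀ k, ∃ u : ℂ, ‖u‖ < 1 ∧
      (∑ v ∈ P.support, (q v).eval (z₀ (k + K₁) + u / 1) *
        exp (1 * (z₀ (k + K₁) + u / 1) + 0) ^ (e v)) = 0 := by
    intro k
    obtain ⟨u, hu, hu0⟩ := hK₁ (k + K₁) (Nat.le_add_left _ _)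
    rw [mem_ball, dist_zero_right] at hu
    refine ⟨u, hu.trans_le (min_le_left _ _), ?_⟩
    simpa using hu0
  choose u hu1 hu0 using hsol
  -- the zeros and their position
  refine ⟨fun k => z₀ (k + K₁) + u k, fun k => nn (k + K₁), |μ|,
    2 + ‖c₀‖ + |μ| * (‖c₀‖ + 4), abs_nonneg μ, ?_, fun k => ?_, fun k => ?_⟩
  · exact hnn_t.comp (tendsto_add_atTop_nat K₁)
  · rw [eval₂_exp_eq_sum]
    have := hu0 k
    simp only [hq_def, he_def, div_one] at this
    exact this
  · -- `‖z₀ - w‖ ≤ 1 + |μ|(log ‖w‖ + 4)`, `w = i n + c₀`, `log ‖w‖ ≤ log n + ‖c₀‖`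
    have hd := (hroot (k + K₁)).2.2.2.1
    have hlo := hw_lo (k + K₁)
    have hhi := hw_hi (k + K₁)
    simp only [norm_one, div_one, sub_zero] at hd
    set w : ℂ := ((((k + K₁ + K₀ + 1 : ℕ) : ℤ) * (1 : ℤ) : ℤ) : ℂ) * (2 * Real.pi * I) + c₀
      with hw
    have hnnk : nn (k + K₁) = 2 * Real.pi * (((k + K₁ + K₀ : ℕ) : ℝ) + 1) := rfl
    have hn1 : 1 ≤ nn (k + K₁) := by
      rw [hnnk]
      have : (0 : ℝ) ≤ ((k + K₁ + K₀ : ℕ) : ℝ) := Nat.cast_nonneg _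
      have := Real.pi_gt_three
      nlinarith
    have hwI : w - c₀ = (nn (k + K₁) : ℂ) * I := by
      simp only [hw, hnnk]; push_cast; ring
    -- `log ‖w‖ ≤ log (n + ‖c₀‖) ≤ log n + ‖c₀‖`
    have hlogw : Real.log ‖w‖ ≤ Real.log (nn (k + K₁)) + ‖c₀‖ := by
      have hlognn : 0 ≤ Real.log (nn (k + K₁)) := Real.log_nonneg hn1
      rcases (norm_nonneg w).eq_or_lt with hw0 | hwpos
      · rw [← hw0, Real.log_zero]; positivity
      have h1 : Real.log ‖w‖ ≤ Real.log (nn (k + K₁) + ‖c₀‖) := Real.log_le_log hwpos hhi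
      have h2 : Real.log (nn (k + K₁) + ‖c₀‖) - Real.log (nn (k + K₁)) ≤ ‖c₀‖ := by
        rw [← Real.log_div (by positivity) (by positivity)]
        have h3 := Real.log_le_sub_one_of_pos (show 0 < (nn (k + K₁) + ‖c₀‖) / nn (k + K₁) by
          positivity)
        have h4 : (nn (k + K₁) + ‖c₀‖) / nn (k + K₁) - 1 = ‖c₀‖ / nn (k + K₁) := by
          field_simp
          ring
        have h5 : ‖c₀‖ / nn (k + K₁) ≤ ‖c₀‖ := div_le_self (norm_nonneg _) hn1
        linarith
      linarith
    have hμ0 : 0 ≤ |μ| := abs_nonneg μ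
    calc ‖z₀ (k + K₁) + u k - (nn (k + K₁) : ℂ) * I‖
        = ‖(z₀ (k + K₁) - w) + u k + c₀‖ := by rw [← hwI]; ring_nf
      _ ≤ ‖z₀ (k + K₁) - w‖ + ‖u k‖ + ‖c₀‖ := norm_add₃_le
      _ ≤ (1 + |μ| * (Real.log ‖w‖ + 4)) + 1 + ‖c₀‖ :=
          add_le_add (add_le_add hd (hu1 k).le) le_rfl
      _ ≤ |μ| * Real.log (nn (k + K₁)) + (2 + ‖c₀‖ + |μ| * (‖c₀‖ + 4)) := by
          nlinarith [mul_le_mul_of_nonneg_left hlogw hμ0]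

end Summit.Schanuel.Schanuel.Theorems
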